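import Summits.RiemannHypothesis.RiemannHypothesis.Theorems.HandoffDodgerSlabFourCeiling
import Summits.RiemannHypothesis.RiemannHypothesis.Theorems.HandoffDodgerSlabThreeCeiling
import HarnessLib

/-!
# HANDOFF — THE RH-FREE ZERO-SUM FAMILY, WALL CEILING AND UPPER CLAUSE FROM `q₀ = 7100` (rh-explicit, W-P(P2) crux 19185, seat dodger-p2 gen0; DODGER-STAGE2-PLAN §2)

RH-FREE. HONEST FRAMING: nothing here bears on the truth of RH; every statement is an UPPER bound on the wall offsets
`δ*(q) = a*(S_q) − (log q)/2` or an upper clause `a*(S_q) < (log q')/2` (RH is the LOWER clause `∀ q, 0 ≤ δ*(q)`, not touched).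

The glue of this seat's fourth slab `[7100, 12500)` (`HandoffDodgerSlabFourCeiling.subwindowZeroSum_slabFour`, on the window witness
`dodger_witness_explicit_window`) with gen13's family from `12500` (`HandoffDodgerSlabThreeCeiling.subwindowZeroSumFamily_twelveThousandFiveHundred`:
slabs `[12500, 25000)`, `[25000, 30000)`, `[30000, 60000)` and gen11's `q ≥ 60000`):
* `subwindowZeroSumFamily_sevenThousandOneHundred : SubwindowZeroSumFamily (1/5) 7100`;
* `dodgerWallCeiling_sevenThousandOneHundred : DodgerWallCeiling (1/5) 7100`;
* **`upperClause_from_sevenThousandOneHundred`** — the UPPER CLAUSE `a*(S_q) < (log q⁺)/2` for EVERY prime `q ≥ 7100`, GAP-BLIND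
  (in particular at all 606 lower-twin primes of the WEIL route's wall `WallsSixtyKTwin`, stmt 19185, and at 43 of the 193 of `WallsTenKTwin`, 19172);
* **`classLaw_from_sevenThousandOneHundred`** (the `∀ q' > q` currency of the route's leaf — the one-line closer of 19185 consumes it) and
  `semilocalClassLawTail_iff_range_sevenThousandOneHundred` / `semilocalClassLawAll_iff_upperClause_range_sevenThousandOneHundred`
  (the WEIL route's crux C-I(a) ⟺ the upper clause at the primes `q < 7100`).
No `sorry`, standard axioms; every ingredient is a theorem of this track or of Mathlib.

References: this track (ATTEMPT-16 THEOREMS 16.1–16.2, ATTEMPT-19 §7–§8, ATTEMPT-21, ATTEMPT-23 §1–§7; HOME/rh-explicit-dodger-p2/DODGER-STAGE2-PLAN.md §2).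
-/

set_option linter.dupNamespace false

noncomputable section

open Real Complex Set MeasureTheory Literature.NumberTheory.LFunctions Literature.NumberTheory.LFunctions.WeilContinuous

namespace Summit.RiemannHypothesis.RiemannHypothesis.Theorems.Handoff

open Summit.RiemannHypothesis.RiemannHypothesis.Theorems.MotivicDoor.SemilocalThreshold
open Summit.RiemannHypothesis.RiemannHypothesis.Theorems.HandoffDecomposition (nextPrime nextPrime_prime lt_nextPrime nextPrime_le consecutivePrimes_nextPrime)
open Summit.RiemannHypothesis.RiemannHypothesis.Theorems.SemilocalClassLaw

/-- **THEOREM (the RH-free zero-sum family at rate `(1/5)(log q)^{3/2}q^{−3/2}` from `q₀ = 7100` on)** — this seat's fourth slab glued with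
gen13's family from `12500`. [this track, ATTEMPT-16 THEOREM 16.2; ATTEMPT-23 §7; DODGER-STAGE2-PLAN §2] -/
theorem subwindowZeroSumFamily_sevenThousandOneHundred : SubwindowZeroSumFamily (1 / 5) 7100 := by
  intro q q' hqq' hq₀
  rcases Nat.lt_or_ge q 12500 with hlt | hge
  · exact subwindowZeroSum_slabFour hqq' hq₀ hlt
  · exact subwindowZeroSumFamily_twelveThousandFiveHundred q q' hqq' hge

/-- **COROLLARY (the Dodger wall ceiling from `7100`, RH-free).** `∀ primes q ≥ 7100, δ*(q) ≤ (1/5)(log q)^{3/2} q^{−3/2}`.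
[this track, DODGER-STAGE2-PLAN §2] -/
theorem dodgerWallCeiling_sevenThousandOneHundred : DodgerWallCeiling (1 / 5) 7100 :=
  dodgerWallCeiling_of_zeroSumFamily subwindowZeroSumFamily_sevenThousandOneHundred

/-- **COROLLARY (the RH-free UPPER CLAUSE from `q₀ = 7100`, GAP-BLIND).** For every prime `q ≥ 7100`:
`a*(S_{<q}) < (log q⁺)/2`, `q⁺` the next prime — in particular at every lower-twin prime of the WEIL route's walls `WallsSixtyKTwin`
(stmt 19185, all of it) and `WallsTenKTwin` (19172, the part `q ≥ 7100`). [this track, DODGER-STAGE2-PLAN §2] -/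
theorem upperClause_from_sevenThousandOneHundred {q : ℕ} (hq : q.Prime) (hq₀ : 7100 ≤ q) :
    weilSemilocalThreshold (Nat.primesBelow q) < Real.log (nextPrime q) / 2 := by
  have hqq' := consecutivePrimes_nextPrime hq
  obtain ⟨θ, δ, hθ, hθs, hδ, -, hwin, hneg⟩ :=
    subwindowWitnessFamily_of_zeroSumFamily subwindowZeroSumFamily_sevenThousandOneHundred q (nextPrime q) hqq' hq₀
  have h := wallOffset_lt_of_translatePair hqq' hθ hθs hδ hwin hneg
  simp only [HandoffMarginLaw.wallOffset] at h
  linarith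

/-- C-I(a) at every prime `q ≥ 7100`, in the `∀ q' > q` currency of the WEIL route's leaf — this IS the sentence of `WallsSixtyKTwin`
(stmt 19185) at every prime `q ≥ 7100`, twin or not; the closer of 19185 is `fun q hq h₁ _ _ q' hq' hlt ↦
classLaw_from_sevenThousandOneHundred hq (by omega) q' hq' hlt`. [this track, DODGER-STAGE2-PLAN §2] -/
theorem classLaw_from_sevenThousandOneHundred {q : ℕ} (hq : q.Prime) (hq₀ : 7100 ≤ q) :
    ∀ q' : ℕ, q'.Prime → q < q' → weilSemilocalThreshold (Nat.primesBelow q) < Real.log q' / 2 :=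
  forall_prime_gt_lt_iff_upperClause.2 (upperClause_from_sevenThousandOneHundred hq hq₀)

/-- **THE WEIL ROUTE'S CRUX REDUCED TO `q < 7100` (RH-free bookkeeping).** `SemilocalClassLawTail` (C-I(a) for all primes `q ≥ 80`)
holds iff the upper clause holds at the primes `80 ≤ q < 7100`. [this track, DODGER-STAGE2-PLAN §2] -/
theorem semilocalClassLawTail_iff_range_sevenThousandOneHundred :
    SemilocalClassLawTail ↔
      ∀ q : ℕ, q.Prime → 80 ≤ q → q < 7100 →
        weilSemilocalThreshold (Nat.primesBelow q) < Real.log (nextPrime q) / 2 := by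
  rw [semilocalClassLawTail_iff_forall_upperClause]
  refine ⟨fun h q hq h80 _ ↦ h q hq h80, fun h q hq h80 ↦ ?_⟩
  rcases Nat.lt_or_ge q 7100 with hlt | hge
  · exact h q hq h80 hlt
  · exact upperClause_from_sevenThousandOneHundred hq hge

/-- The whole leaf likewise: `SemilocalClassLawAll` iff the upper clause at every prime `q < 7100`. [this track, DODGER-STAGE2-PLAN §2] -/
theorem semilocalClassLawAll_iff_upperClause_range_sevenThousandOneHundred :
    SemilocalClassLawAll ↔
      ∀ q : ℕ, q.Prime → q < 7100 → weilSemilocalThreshold (Nat.primesBelow q) < Real.log (nextPrime q) / 2 := by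
  rw [semilocalClassLawAll_iff_forall_upperClause]
  refine ⟨fun h q hq _ ↦ h q hq, fun h q hq ↦ ?_⟩
  rcases Nat.lt_or_ge q 7100 with hlt | hge
  · exact h q hq hlt
  · exact upperClause_from_sevenThousandOneHundred hq hge

end Summit.RiemannHypothesis.RiemannHypothesis.Theorems.Handoff

end
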